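import Summits.QuantumFields.BalabanUV.Beta.FP.AveragingJetLetters

/-!
# `Beta/FP/AveragingJetLettersRooted` — road «FP» (binder row D1), row **RHOA-6b′** «ROOTED LETTERS — GENERIC ROOTED FAMILY»: the first averaging jet of a
# probability-weighted family of ROOTED insertion paths as a KERNEL, its letters (SUP ∕ RADIUS ∕ MASS) with every hypothesis displayed; block families at blocking `n`

HONEST FRAMING (cell `pub-balaban`, β sub-cell, verbatim): discharging `BetaPertH` makes Bałaban's UV stability UNCONDITIONAL — a real constructive-QFT
result; it is NOT the continuum limit and NOT the Clay problem.  THIS MODULE discharges NOTHING of the series, of row D1, of `hbook`/`hasym`/`ρ_n`/`Mix_n`: it is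
[folklore] finite bookkeeping (lists, `Finset` sums, one `n⁻⁴` count) over node 6 «ADJOINT-TRANSPORT-JETS» (`Beta.AdjointTransportJets.avgPath`/`avgJet₁`) and the
road's index set (`AxialBlockWeights.idx`/`pt`/`fiber`, `card_idx`, `card_fiber_le`) BY NAME.  «not in print; our bookkeeping».  0 estimates of any Bałaban
propagator; NO road object is identified here.
HONEST DEPENDENCY: continuum YM on T⁴ ⇐ BetaPertH ∧ nine spine estimates (0/9 proved); BetaPertH ⇐ (D1) ∧ (D4) ∧ CAP+tail; G-an2-4 gates asym, D1 and NE2/3/4.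

ABSOLUTE RULE (cell charter, verbatim): «No internally-minted statement may enter as a cited fact. Every hypothesis is either kernel-proved in this package or a
verbatim quotation of a PUBLISHED theorem with page reference. The manuscript(s) under audit are NOT citable for their own disputed steps — they are the thing under
adjudication; programme-internal (2001/route/tribunal) claims are never citable.»  Accordingly: no `def … : Prop`, no citation tag, no hypothesis is a printed
statement; the data `def`s below (`wfld`, `ker₁`, `mass₁`; `blkW`, `blkFld`, `blkBg`) assert nothing.

THE ROW (road-FP owner b2b-balaban-beta-d1-p3, ruling R-FP-26 (b), `HOME/b2b-balaban-beta-d1-p3/ROOTING-MIX.md` §4, AMENDED in the owner's S5-answer (d) to the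
GENERIC ROOTED FAMILY, verbatim): «for any finite probability-weighted family of rooted lattice contours `Γ_{c,x}` with `|Γ| ≤ ℓ = (2d+2)n` (comb `gammaCAt (ctr)`,
B12 (0.4) `BlockAveraging.loopWord∕stairWord σ` S_D-mean, (0.12)), the first∕second averaging jets at 𝟙 have: sup `≤ n⁻⁴`(×norm), radius `≤ ℓ`, MASS FUNCTION with
`Σ_{b∈window(u)} m(b) ≤ ℓ` per coarse bond (the count `n⁻⁵·Σ_{(x,s)}|path| ≤ ℓ`)» — instance-free (ROOTING-MIX §1(c)/§2: `r(u; b′, b) = ± n⁻⁵·#{s < n : x := b − s·e_μ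
∈ B(y), b′ ∈ Γ_{r(y),x}}`, sup `n⁻⁵·n = n⁻⁴`, per-insertion mass `m(b′) = Σ_u Σ_b |r(u;b′,b)|`, total `≤ (2d+2)n`).

CONVENTION ((q̇) ONE-SIDED, RHOA-DESIGN v1.1 §2bis ∕ `FP/AveragingJetLetters`): an EVENT `e` carries a weight `ω e`, a FIELD LEG `fld e` (label of the bond carrying the
fluctuation letter) and a BACKGROUND WORD `bg e` (labels of the bonds it is transported back through, in path order); the object is node 6's
`avgPath ℝ ω (fun e ↦ (bg e).map β) (fun e ↦ φ (fld e))` BY NAME, with first jet node 6's stencil `avgJet₁` (`hasDerivAt_avgPath_zero`).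

WHAT IS TYPED.
* §0 [folklore] list helpers: a mapped list sum as a `count`-weighted `Finset` sum over any superset of its letters; `Σ_{b∈S} count b l ≤ |l|` (`=` on a superset).
* §1 GENERIC ROOTED INSERTION FAMILY (events `ι` a `Fintype`; labels `B`, `C`): `wfld ω fld c = Σ_{e : fld e = c} ω e` (WEIGHTED FIELD-POINT COUNT — the currency in which
  «n⁻⁴» is an instance value), `ker₁ ω fld bg b c = Σ_{e : fld e = c} ω e·count b (bg e)` (MAJORANT KERNEL of the first jet), `mass₁ ω bg b = Σ_e ω e·count b (bg e)`
  (INSERTION-SIDE MASS FUNCTION); KERNEL FORM **`avgJet₁_eq_sum_ker₁`** (`avgJet₁ = Σ_{b∈S} Σ_{c∈T} ker₁ b c • [β b, φ c]`, any finite `S ⊇` letters, `T ⊇` field legs);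
  LETTERS: `ker₁_nonneg`; SUPPORT `exists_of_ker₁_ne_zero`, transfer form `ker₁_eq_zero_of_rel` (any relation between background letters and their field leg passes to
  the support — the RADIUS letter is an instance); SUP **`ker₁_le_mul_wfld`** (`count ≤ M ⟹ ker₁ b c ≤ M·wfld c`); MASS **`sum_sum_ker₁_le`** (`|bg e| ≤ ℓ ⟹
  Σ_{b∈S}Σ_{c∈T} ker₁ ≤ ℓ·Σ_e ω e`, ALL finite windows — the row's count), `sum_ker₁_le_mass₁`/`sum_ker₁_eq_mass₁`, `sum_mass₁_le`/`sum_mass₁_eq`; FIELD-SIDE MASS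
  **`sum_ker₁_le_mul_wfld`** (`Σ_{b∈S} ker₁ b c ≤ ℓ·wfld c`); second-jet PAIR MASS `sum_pairMass_le` (`Σ_e ω e·|bg e|² ≤ ℓ²·Σ_e ω e`; the kernel form of `q̈` is NOT
  typed here — RHOA-6b deferred it to `AveragingJetLettersSecond` likewise).
* §2 BLOCK FAMILIES at blocking `n` on `Pt = ℤ⁴` (radial-rule generic): rules `σ : Σ` (a `Fintype`), probabilities `p σ`, events `(q, σ)`, `q = (x′, s) ∈ idx n`, weight
  `blkW = n⁻⁵·p σ`, field leg `blkFld = n•y + pt μ q` ON THE STRAIGHT SEGMENT (ROOTING-MIX §1(c)), word `blkBg = rad σ y x′ ++ [strB (n•y + pt μ (x′,j)) : j < s]`;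
  `sum_blkW` (`Σ_e ω e = Σ_σ p σ`), **`wfld_blk_le`** (`wfld c ≤ n⁻⁴·Σ_σ p σ`: at most `n` positions share a field point), `length_blkBg_le` (`≤ ℓ₀ + n` from the
  displayed radial letter `|rad σ y x′| ≤ ℓ₀`), `count_blkBg_le(_two)` (multiplicity `≤ count b (rad …) + 1`; `≤ 2` for simple radial words, injective `strB`); the
  row's letters AS INSTANCES **`blk_sup_le`** (`≤ M·n⁻⁴·Σp`), **`blk_sup_le_two`**, **`blk_mass_le`** (`≤ (ℓ₀+n)·Σp`), `blk_massFun_le`, **`blk_fieldMass_le`**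
  (`≤ (ℓ₀+n)·n⁻⁴·Σp`), `blk_support`; `hasDerivAt_blkAvg_zero` + `blkJet₁_eq_sum_ker₁` (node 6 + §1 BY NAME).

NOT TYPED HERE (scope): the radial rules themselves — comb (node 5ρ `gammaCAt (ctr n)`'s axial leg as a bond word) and B12 (0.4)'s S_D-orbit of staircases — attach BY
NAME when the re-based literal's tables land (owner S5-answer (d)); the ALL-BONDS event set (fluctuation letters on the radial bonds too, as in an1's loop words
`hessUAt`/`vhUAt ρ`) — §1 covers it verbatim, its `wfld` profile is NOT `n⁻⁴` at the trunk (owner's call); the CLOSING radial leg `(Γ_{r(y+e_μ),x+n·e_μ})⁻¹`: its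
letters come AFTER every field letter in the loop word, so they do NOT enter `ker₁` (one-sided convention) — they enter only the second jet ∕ an1's `hessUAt` words
(RHOA-6b pt 3's domain; owner GO l.25401 (ii)); (MIX) power counting (RHOA-6c′), `Mix_n = O(1)` (RHOA-6e), `hbook`, D1, BetaPertH.  Nothing printed is asserted; B12 p.251–252 (0.3)/(0.4) and B5-I (1.11) are LOCATORS for which object is modelled.
Provenance: cross-cell idle-seat kernel duty NE7b → β∕D1, unit `b2b-balaban-t4-ne7b-formalise-leaf-02` gen 22 (prover-…-leaf-02-g22-0), 2026-08-21; journal INTENT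
«RHOA-6b′» l.25378, owner «GO, THIS SHAPE» l.25401; no existing file touched.
-/

noncomputable section

namespace Summit.QuantumFields.BalabanUV.Beta.FP.AveragingJetLettersRooted

open Finset
open scoped BigOperators
open Literature.MathematicalPhysics.QuantumFieldTheory.Balaban1983to89.Beta.DyadicShell (Pt)
open Literature.MathematicalPhysics.QuantumFieldTheory.Balaban1983to89.Beta.AxialBlockWeights (idx pt card_idx fiber card_fiber_le)
open Literature.MathematicalPhysics.QuantumFieldTheory.Balaban1983to89.Beta.AdjointTransportJets (avgPath avgJet₁ hasDerivAt_avgPath_zero)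
open Summit.QuantumFields.BalabanUV.Beta.FP.AveragingJetLetters (mem_idx_iff pt_pos_injective)

section Generic

variable {ι : Type*} [Fintype ι] {B : Type*} [DecidableEq B] {C : Type*} [DecidableEq C]

/-! ## §0 List helpers -/

/-- [folklore] a mapped list sum is the `count`-weighted sum over ANY finite superset of the letters. -/
theorem list_sum_map_eq_sum_count {M : Type*} [AddCommMonoid M] (l : List B) (f : B → M) (S : Finset B)
    (hS : ∀ b ∈ l, b ∈ S) : (l.map f).sum = ∑ b ∈ S, l.count b • f b := by
  rw [Finset.sum_list_map_count]
  refine Finset.sum_subset (fun b hb => hS b (List.mem_toFinset.mp hb)) fun b _ hb => ?_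
  rw [List.count_eq_zero.mpr (fun h => hb (List.mem_toFinset.mpr h)), zero_smul]

/-- [folklore] `Σ_{b∈S} count b l = |l|` for any finite superset `S` of the letters. -/
theorem sum_count_eq_length (l : List B) (S : Finset B) (hS : ∀ b ∈ l, b ∈ S) :
    ∑ b ∈ S, l.count b = l.length := by
  rw [← List.sum_toFinset_count_eq_length]
  symm
  refine Finset.sum_subset (fun b hb => hS b (List.mem_toFinset.mp hb)) fun b _ hb => ?_
  exact List.count_eq_zero.mpr (fun h => hb (List.mem_toFinset.mpr h))

/-- [folklore] `Σ_{b∈S} count b l ≤ |l|` for EVERY finite `S`. -/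
theorem sum_count_le_length (l : List B) (S : Finset B) : ∑ b ∈ S, l.count b ≤ l.length := by
  calc ∑ b ∈ S, l.count b ≤ ∑ b ∈ S ∪ l.toFinset, l.count b :=
        Finset.sum_le_sum_of_subset subset_union_left
    _ = l.length := sum_count_eq_length l _ fun b hb => mem_union_right _ (List.mem_toFinset.mpr hb)

/-! ## §1 The generic rooted insertion family: kernel form and letters -/

/-- [our object] THE WEIGHTED FIELD-POINT COUNT `wfld c = Σ_{e : fld e = c} ω e`. -/
def wfld (ω : ι → ℝ) (fld : ι → C) (c : C) : ℝ := ∑ e ∈ univ.filter (fun e => fld e = c), ω e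

/-- [our object] THE MAJORANT KERNEL OF THE FIRST JET `ker₁ b c = Σ_{e : fld e = c} ω e · count b (bg e)` (total weight with which `b` precedes `c`). -/
def ker₁ (ω : ι → ℝ) (fld : ι → C) (bg : ι → List B) (b : B) (c : C) : ℝ :=
  ∑ e ∈ univ.filter (fun e => fld e = c), ω e * ((bg e).count b : ℝ)

/-- [our object] THE INSERTION-SIDE MASS FUNCTION `mass₁ b = Σ_e ω e · count b (bg e)`. -/
def mass₁ (ω : ι → ℝ) (bg : ι → List B) (b : B) : ℝ := ∑ e, ω e * ((bg e).count b : ℝ)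

variable {ω : ι → ℝ} {fld : ι → C} {bg : ι → List B}

/-- [folklore] (L0) `ker₁ ≥ 0` for nonnegative weights. -/
theorem ker₁_nonneg (hω : ∀ e, 0 ≤ ω e) (b : B) (c : C) : 0 ≤ ker₁ ω fld bg b c :=
  Finset.sum_nonneg fun e _ => mul_nonneg (hω e) (Nat.cast_nonneg _)

/-- [folklore] `mass₁ ≥ 0` for nonnegative weights. -/
theorem mass₁_nonneg (hω : ∀ e, 0 ≤ ω e) (b : B) : 0 ≤ mass₁ ω bg b :=
  Finset.sum_nonneg fun e _ => mul_nonneg (hω e) (Nat.cast_nonneg _)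

/-- [folklore] SUPPORT: a nonzero kernel entry is witnessed by an event with field leg `c` whose background word contains `b`. -/
theorem exists_of_ker₁_ne_zero {b : B} {c : C} (h : ker₁ ω fld bg b c ≠ 0) : ∃ e, fld e = c ∧ b ∈ bg e := by
  by_contra hne
  push Not at hne
  apply h
  refine Finset.sum_eq_zero fun e he => ?_
  have hc : fld e = c := (Finset.mem_filter.mp he).2
  rw [List.count_eq_zero.mpr (hne e hc), Nat.cast_zero, mul_zero]

/-- [folklore] SUPPORT TRANSFER (the RADIUS letter is an instance): a relation between every background letter and its field leg holds on the support. -/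
theorem ker₁_eq_zero_of_rel (R : B → C → Prop) (hR : ∀ e, ∀ b ∈ bg e, R b (fld e)) {b : B} {c : C}
    (h : ¬ R b c) : ker₁ ω fld bg b c = 0 := by
  by_contra hne
  obtain ⟨e, hc, hb⟩ := exists_of_ker₁_ne_zero hne
  exact h (hc ▸ hR e b hb)

/-- [folklore] (SUP) `count b (bg e) ≤ M` for every event ⟹ `ker₁ b c ≤ M · wfld c`. -/
theorem ker₁_le_mul_wfld (hω : ∀ e, 0 ≤ ω e) {M : ℕ} {b : B} (hM : ∀ e, (bg e).count b ≤ M) (c : C) :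
    ker₁ ω fld bg b c ≤ (M : ℝ) * wfld ω fld c := by
  unfold ker₁ wfld
  rw [Finset.mul_sum]
  refine Finset.sum_le_sum fun e _ => ?_
  rw [mul_comm (M : ℝ)]
  exact mul_le_mul_of_nonneg_left (by exact_mod_cast hM e) (hω e)

/-- [folklore] summing the kernel over ANY finite field window is at most the mass function. -/
theorem sum_ker₁_le_mass₁ (hω : ∀ e, 0 ≤ ω e) (T : Finset C) (b : B) :
    ∑ c ∈ T, ker₁ ω fld bg b c ≤ mass₁ ω bg b := by
  unfold ker₁ mass₁
  have h := Finset.sum_fiberwise_le_sum_of_sum_fiber_nonneg (s := (univ : Finset ι)) (t := T) (g := fld)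
    (f := fun e => ω e * ((bg e).count b : ℝ)) ?_
  · simpa using h
  · intro c _
    exact Finset.sum_nonneg fun e _ => mul_nonneg (hω e) (Nat.cast_nonneg _)

/-- [folklore] on a field window containing every field leg the kernel sums EXACTLY to the mass function. -/
theorem sum_ker₁_eq_mass₁ (T : Finset C) (hT : ∀ e, fld e ∈ T) (b : B) :
    ∑ c ∈ T, ker₁ ω fld bg b c = mass₁ ω bg b := by
  unfold ker₁ mass₁
  exact Finset.sum_fiberwise_of_maps_to (fun e _ => hT e) _

/-- [folklore] the mass function summed over a window containing every letter is the weighted total word length. -/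
theorem sum_mass₁_eq (S : Finset B) (hS : ∀ e, ∀ b ∈ bg e, b ∈ S) :
    ∑ b ∈ S, mass₁ ω bg b = ∑ e, ω e * ((bg e).length : ℝ) := by
  unfold mass₁
  rw [Finset.sum_comm]
  refine Finset.sum_congr rfl fun e _ => ?_
  rw [← Finset.mul_sum, ← Nat.cast_sum, sum_count_eq_length (bg e) S (hS e)]

/-- [folklore] (MASS FUNCTION) `|bg e| ≤ ℓ` for every event ⟹ `Σ_{b∈S} mass₁ b ≤ ℓ · Σ_e ω e` for EVERY finite `S`. -/
theorem sum_mass₁_le (hω : ∀ e, 0 ≤ ω e) {ℓ : ℕ} (hℓ : ∀ e, (bg e).length ≤ ℓ) (S : Finset B) :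
    ∑ b ∈ S, mass₁ ω bg b ≤ (ℓ : ℝ) * ∑ e, ω e := by
  unfold mass₁
  rw [Finset.sum_comm, Finset.mul_sum]
  refine Finset.sum_le_sum fun e _ => ?_
  rw [← Finset.mul_sum, mul_comm (ℓ : ℝ)]
  refine mul_le_mul_of_nonneg_left ?_ (hω e)
  calc ∑ b ∈ S, (((bg e).count b : ℕ) : ℝ) ≤ ((bg e).length : ℝ) := by exact_mod_cast sum_count_le_length (bg e) S
    _ ≤ ℓ := by exact_mod_cast hℓ e

/-- [folklore] **(MASS) THE ROW's COUNT**: `|bg e| ≤ ℓ` ⟹ `Σ_{b∈S} Σ_{c∈T} ker₁ b c ≤ ℓ · Σ_e ω e` for ALL finite windows (probability weights: `≤ ℓ`). -/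
theorem sum_sum_ker₁_le (hω : ∀ e, 0 ≤ ω e) {ℓ : ℕ} (hℓ : ∀ e, (bg e).length ≤ ℓ) (S : Finset B) (T : Finset C) :
    ∑ b ∈ S, ∑ c ∈ T, ker₁ ω fld bg b c ≤ (ℓ : ℝ) * ∑ e, ω e :=
  (Finset.sum_le_sum fun b _ => sum_ker₁_le_mass₁ hω T b).trans (sum_mass₁_le hω hℓ S)

/-- [folklore] **(FIELD-SIDE MASS)**: `|bg e| ≤ ℓ` ⟹ `Σ_{b∈S} ker₁ b c ≤ ℓ · wfld c` for every field leg `c` and every finite `S`. -/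
theorem sum_ker₁_le_mul_wfld (hω : ∀ e, 0 ≤ ω e) {ℓ : ℕ} (hℓ : ∀ e, (bg e).length ≤ ℓ) (S : Finset B) (c : C) :
    ∑ b ∈ S, ker₁ ω fld bg b c ≤ (ℓ : ℝ) * wfld ω fld c := by
  unfold ker₁ wfld
  rw [Finset.sum_comm, Finset.mul_sum]
  refine Finset.sum_le_sum fun e _ => ?_
  rw [← Finset.mul_sum, mul_comm (ℓ : ℝ)]
  refine mul_le_mul_of_nonneg_left ?_ (hω e)
  calc ∑ b ∈ S, (((bg e).count b : ℕ) : ℝ) ≤ ((bg e).length : ℝ) := by exact_mod_cast sum_count_le_length (bg e) S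
    _ ≤ ℓ := by exact_mod_cast hℓ e

omit [DecidableEq B] in
/-- [folklore] (PAIR MASS of the second jet) `|bg e| ≤ ℓ` ⟹ `Σ_e ω e·|bg e|² ≤ ℓ²·Σ_e ω e`. -/
theorem sum_pairMass_le (hω : ∀ e, 0 ≤ ω e) {ℓ : ℕ} (hℓ : ∀ e, (bg e).length ≤ ℓ) :
    ∑ e, ω e * ((bg e).length : ℝ) ^ 2 ≤ (ℓ : ℝ) ^ 2 * ∑ e, ω e := by
  rw [Finset.mul_sum]
  refine Finset.sum_le_sum fun e _ => ?_
  rw [mul_comm ((ℓ : ℝ) ^ 2)]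
  refine mul_le_mul_of_nonneg_left ?_ (hω e)
  have h : ((bg e).length : ℝ) ≤ ℓ := by exact_mod_cast hℓ e
  exact pow_le_pow_left₀ (Nat.cast_nonneg _) h 2

/-- [folklore] one event: `[Σ (bg e).map β, φ c] = Σ_{b∈S} count b (bg e) • [β b, φ c]`. -/
theorem word_comm_eq_sum_count {𝔸 : Type*} [NormedRing 𝔸] [NormedAlgebra ℝ 𝔸] (l : List B) (β : B → 𝔸) (a : 𝔸)
    (S : Finset B) (hS : ∀ b ∈ l, b ∈ S) :
    (l.map β).sum * a - a * (l.map β).sum = ∑ b ∈ S, ((l.count b : ℕ) : ℝ) • (β b * a - a * β b) := by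
  rw [list_sum_map_eq_sum_count l β S hS, Finset.sum_mul, Finset.mul_sum, ← Finset.sum_sub_distrib]
  refine Finset.sum_congr rfl fun b _ => ?_
  rw [Nat.cast_smul_eq_nsmul, smul_mul_assoc, mul_smul_comm, smul_sub]

/-- **THE KERNEL FORM OF THE FIRST JET**: for any finite `S` ⊇ background letters and `T` ⊇ field legs,
`avgJet₁ ℝ ω ((bg ·).map β) (φ ∘ fld) = Σ_{b∈S} Σ_{c∈T} ker₁ b c • [β b, φ c]`. [folklore] -/
theorem avgJet₁_eq_sum_ker₁ {𝔸 : Type*} [NormedRing 𝔸] [NormedAlgebra ℝ 𝔸] (ω : ι → ℝ) (fld : ι → C) (bg : ι → List B)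
    (S : Finset B) (T : Finset C) (hS : ∀ e, ∀ b ∈ bg e, b ∈ S) (hT : ∀ e, fld e ∈ T) (β : B → 𝔸) (φ : C → 𝔸) :
    avgJet₁ ℝ ω (fun e => (bg e).map β) (fun e => φ (fld e))
      = ∑ b ∈ S, ∑ c ∈ T, ker₁ ω fld bg b c • (β b * φ c - φ c * β b) := by
  unfold avgJet₁
  have h1 : ∀ e, ω e • (((bg e).map β).sum * φ (fld e) - φ (fld e) * ((bg e).map β).sum)
      = ∑ b ∈ S, (ω e * (((bg e).count b : ℕ) : ℝ)) • (β b * φ (fld e) - φ (fld e) * β b) := by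
    intro e
    rw [word_comm_eq_sum_count (bg e) β (φ (fld e)) S (hS e), Finset.smul_sum]
    refine Finset.sum_congr rfl fun b _ => ?_
    rw [smul_smul]
  simp_rw [h1]
  rw [Finset.sum_comm]
  refine Finset.sum_congr rfl fun b _ => ?_
  rw [← Finset.sum_fiberwise_of_maps_to (s := (univ : Finset ι)) (t := T) (g := fld) (fun e _ => hT e)]
  refine Finset.sum_congr rfl fun c _ => ?_
  unfold ker₁
  rw [Finset.sum_smul]
  refine Finset.sum_congr rfl fun e he => ?_
  rw [(Finset.mem_filter.mp he).2]

end Generic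

/-! ## §2 Block families at blocking `n` (radial-rule generic) -/

section Block

variable {σ : Type*} [Fintype σ] {B : Type*} [DecidableEq B]

/-- [our object] the event weight `n⁻⁵ · p σ` of the block family. -/
def blkW (n : ℕ) (p : σ → ℝ) (e : ↥(idx n) × σ) : ℝ := ((n : ℝ) ^ 5)⁻¹ * p e.2

/-- [our object] the field leg of the event `((x′, s), σ)` of block `y`: the straight-segment bond `n•y + x′ + s·e_μ` (base point, direction `μ`). -/
def blkFld (n : ℕ) (μ : Fin 4) (y : Pt) (e : ↥(idx n) × σ) : Pt := n • y + pt μ e.1.1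

/-- [our object] the background word of `((x′, s), σ)`: the radial word `rad σ y x′` (root → block point, rule `σ`) then the straight bonds `j < s` (labels `strB`). -/
def blkBg (n : ℕ) (μ : Fin 4) (y : Pt) (rad : σ → Pt → Pt → List B) (strB : Pt → B) (e : ↥(idx n) × σ) : List B :=
  rad e.2 y e.1.1.1 ++ (List.range e.1.1.2).map fun j => strB (n • y + pt μ (e.1.1.1, j))

omit [Fintype σ] in
/-- [folklore] the weights are nonnegative for nonnegative probabilities. -/
theorem blkW_nonneg (n : ℕ) {p : σ → ℝ} (hp : ∀ s, 0 ≤ p s) (e : ↥(idx n) × σ) : 0 ≤ blkW n p e :=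
  mul_nonneg (by positivity) (hp e.2)

/-- [folklore] TOTAL WEIGHT: `Σ_e blkW e = Σ_σ p σ` (`#idx n = n⁵`, `n ≥ 1`). -/
theorem sum_blkW {n : ℕ} (hn : 1 ≤ n) (p : σ → ℝ) : ∑ e, blkW n p e = ∑ s, p s := by
  unfold blkW
  rw [Fintype.sum_prod_type]
  simp only [Finset.sum_const, Finset.card_univ, Fintype.card_coe, card_idx]
  have hn' : (n : ℝ) ≠ 0 := by exact_mod_cast (by omega : n ≠ 0)
  rw [← Finset.mul_sum, nsmul_eq_mul, ← mul_assoc, Nat.cast_pow, mul_inv_cancel₀ (pow_ne_zero _ hn'), one_mul]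

/-- [folklore] **THE `n⁻⁴` COUNT**: at most `n` contour positions share a field point, so `wfld c ≤ n⁻⁴ · Σ_σ p σ` (`p ≥ 0`, `n ≥ 1`). -/
theorem wfld_blk_le {n : ℕ} (hn : 1 ≤ n) (μ : Fin 4) (y : Pt) {p : σ → ℝ} (hp : ∀ s, 0 ≤ p s) (c : Pt) :
    wfld (blkW n p) (blkFld (σ := σ) n μ y) c ≤ ((n : ℝ) ^ 4)⁻¹ * ∑ s, p s := by
  classical
  unfold wfld blkW blkFld
  have hn' : (0 : ℝ) < n := by exact_mod_cast hn
  have hP : 0 ≤ ∑ s, p s := Finset.sum_nonneg fun s _ => hp s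
  rw [Finset.sum_filter, Fintype.sum_prod_type]
  have hinner : ∀ q : ↥(idx n), (∑ s : σ, if n • y + pt μ q.1 = c then ((n : ℝ) ^ 5)⁻¹ * p s else 0)
      = if n • y + pt μ q.1 = c then ((n : ℝ) ^ 5)⁻¹ * ∑ s, p s else 0 := fun q => by
    split_ifs with h
    · rw [Finset.mul_sum]
    · simp
  simp_rw [hinner]
  rw [← Finset.sum_filter, Finset.sum_const, nsmul_eq_mul]
  set A := (univ : Finset ↥(idx n)).filter (fun q => n • y + pt μ q.1 = c) with hA
  have hcard : A.card ≤ n := by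
    refine (Finset.card_le_card_of_injOn (fun q => q.1) (fun q hq => ?_) (fun q₁ _ q₂ _ h => Subtype.ext h)).trans
      (card_fiber_le n μ (c - n • y))
    have hq' := (Finset.mem_filter.mp (Finset.mem_coe.mp hq)).2
    rw [fiber, Finset.mem_coe, Finset.mem_filter]
    exact ⟨q.2, by rw [← hq']; abel⟩
  have hcard' : (A.card : ℝ) ≤ n := by exact_mod_cast hcard
  calc (A.card : ℝ) * (((n : ℝ) ^ 5)⁻¹ * ∑ s, p s) ≤ (n : ℝ) * (((n : ℝ) ^ 5)⁻¹ * ∑ s, p s) :=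
        mul_le_mul_of_nonneg_right hcard' (by positivity)
    _ = ((n : ℝ) ^ 4)⁻¹ * ∑ s, p s := by field_simp

omit [Fintype σ] [DecidableEq B] in
/-- [folklore] WORD LENGTH: a radial letter `|rad σ y x′| ≤ ℓ₀` gives `|blkBg e| ≤ ℓ₀ + n` (the straight part has `s < n` letters). -/
theorem length_blkBg_le {n : ℕ} (μ : Fin 4) (y : Pt) {rad : σ → Pt → Pt → List B} (strB : Pt → B) {ℓ₀ : ℕ}
    (hrad : ∀ s x', (rad s y x').length ≤ ℓ₀) (e : ↥(idx n) × σ) :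
    (blkBg n μ y rad strB e).length ≤ ℓ₀ + n := by
  unfold blkBg
  rw [List.length_append, List.length_map, List.length_range]
  have hs : e.1.1.2 < n := (mem_idx_iff.mp e.1.2).2
  have hr := hrad e.2 e.1.1.1
  omega

omit [Fintype σ] in
/-- [folklore] MULTIPLICITY: for injective straight labels `strB` the straight part has no repeated letter, so `count b (blkBg e) ≤ count b (rad σ y x′) + 1`. -/
theorem count_blkBg_le {n : ℕ} (μ : Fin 4) (y : Pt) (rad : σ → Pt → Pt → List B) {strB : Pt → B}
    (hstr : Function.Injective strB) (e : ↥(idx n) × σ) (b : B) :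
    (blkBg n μ y rad strB e).count b ≤ (rad e.2 y e.1.1.1).count b + 1 := by
  unfold blkBg
  rw [List.count_append]
  refine Nat.add_le_add_left ?_ _
  have hnd : ((List.range e.1.1.2).map fun j => strB (n • y + pt μ (e.1.1.1, j))).Nodup := by
    refine (List.nodup_range).map fun j₁ j₂ h => ?_
    have h' := add_left_cancel (hstr h)
    exact pt_pos_injective (q₁ := (e.1.1.1, j₁)) (q₂ := (e.1.1.1, j₂)) rfl h'
  exact List.nodup_iff_count_le_one.mp hnd b

omit [Fintype σ] in
/-- [folklore] MULTIPLICITY for SIMPLE radial words: `rad σ y x′` without repeated letters ⟹ `count b (blkBg e) ≤ 2`. -/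
theorem count_blkBg_le_two {n : ℕ} (μ : Fin 4) (y : Pt) {rad : σ → Pt → Pt → List B} {strB : Pt → B}
    (hrad : ∀ s x', (rad s y x').Nodup) (hstr : Function.Injective strB) (e : ↥(idx n) × σ) (b : B) :
    (blkBg n μ y rad strB e).count b ≤ 2 := by
  have h1 := count_blkBg_le μ y rad hstr e b (n := n)
  have h2 := List.nodup_iff_count_le_one.mp (hrad e.2 e.1.1.1) b
  omega

variable {n : ℕ} {μ : Fin 4} {y : Pt} {p : σ → ℝ} {rad : σ → Pt → Pt → List B} {strB : Pt → B} {ℓ₀ : ℕ}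

/-- [folklore] **THE SUP LETTER, instance**: multiplicity `count b (blkBg e) ≤ M` ⟹ `ker₁ b c ≤ M · n⁻⁴ · Σ_σ p σ`. -/
theorem blk_sup_le (hn : 1 ≤ n) (hp : ∀ s, 0 ≤ p s) {M : ℕ} {b : B}
    (hM : ∀ e, (blkBg n μ y rad strB e).count b ≤ M) (c : Pt) :
    ker₁ (blkW n p) (blkFld n μ y) (blkBg n μ y rad strB) b c ≤ (M : ℝ) * (((n : ℝ) ^ 4)⁻¹ * ∑ s, p s) :=
  (ker₁_le_mul_wfld (blkW_nonneg n hp) hM c).trans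
    (mul_le_mul_of_nonneg_left (wfld_blk_le hn μ y hp c) (Nat.cast_nonneg _))

/-- [folklore] **THE SUP LETTER for SIMPLE radial words, injective straight labels**: `ker₁ b c ≤ 2·n⁻⁴·Σ_σ p σ` (radial word and segment may share one bond). -/
theorem blk_sup_le_two (hn : 1 ≤ n) (hp : ∀ s, 0 ≤ p s) (hrad : ∀ s x', (rad s y x').Nodup)
    (hstr : Function.Injective strB) (b : B) (c : Pt) :
    ker₁ (blkW n p) (blkFld n μ y) (blkBg n μ y rad strB) b c ≤ 2 * (((n : ℝ) ^ 4)⁻¹ * ∑ s, p s) := by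
  have h := blk_sup_le hn hp (fun e => count_blkBg_le_two μ y hrad hstr e b) c (n := n) (rad := rad)
  exact_mod_cast h

/-- [folklore] **THE MASS LETTER, instance (the row's count `n⁻⁵·Σ_{(x,s)}|path|`)**: `Σ_{b∈S} Σ_{c∈T} ker₁ b c ≤ (ℓ₀ + n) · Σ_σ p σ`, ALL finite windows. -/
theorem blk_mass_le (hn : 1 ≤ n) (hp : ∀ s, 0 ≤ p s) (hrad : ∀ s x', (rad s y x').length ≤ ℓ₀)
    (S : Finset B) (T : Finset Pt) :
    ∑ b ∈ S, ∑ c ∈ T, ker₁ (blkW n p) (blkFld n μ y) (blkBg n μ y rad strB) b c ≤ ((ℓ₀ + n : ℕ) : ℝ) * ∑ s, p s := by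
  rw [← sum_blkW hn p]
  exact sum_sum_ker₁_le (blkW_nonneg n hp) (length_blkBg_le μ y strB hrad) S T

/-- [folklore] **THE MASS-FUNCTION WINDOW LETTER per coarse bond `u = (μ, y)`, instance**: `Σ_{b∈window} mass₁ b ≤ (ℓ₀ + n) · Σ_σ p σ` for EVERY finite window
(the per-block total that instantiates RHOA-6c′'s exponentially windowed (M)-letter; owner GO l.25401 (i)). -/
theorem blk_massFun_le (hn : 1 ≤ n) (hp : ∀ s, 0 ≤ p s) (hrad : ∀ s x', (rad s y x').length ≤ ℓ₀)
    (S : Finset B) :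
    ∑ b ∈ S, mass₁ (blkW n p) (blkBg n μ y rad strB) b ≤ ((ℓ₀ + n : ℕ) : ℝ) * ∑ s, p s := by
  rw [← sum_blkW hn p]
  exact sum_mass₁_le (blkW_nonneg n hp) (length_blkBg_le μ y strB hrad) S

/-- [folklore] **THE FIELD-SIDE MASS LETTER, instance**: `Σ_{b∈S} ker₁ b c ≤ (ℓ₀ + n) · n⁻⁴ · Σ_σ p σ`, uniformly in the field leg `c`. -/
theorem blk_fieldMass_le (hn : 1 ≤ n) (hp : ∀ s, 0 ≤ p s) (hrad : ∀ s x', (rad s y x').length ≤ ℓ₀)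
    (S : Finset B) (c : Pt) :
    ∑ b ∈ S, ker₁ (blkW n p) (blkFld n μ y) (blkBg n μ y rad strB) b c
      ≤ ((ℓ₀ + n : ℕ) : ℝ) * (((n : ℝ) ^ 4)⁻¹ * ∑ s, p s) :=
  (sum_ker₁_le_mul_wfld (blkW_nonneg n hp) (length_blkBg_le μ y strB hrad) S c).trans
    (mul_le_mul_of_nonneg_left (wfld_blk_le hn μ y hp c) (Nat.cast_nonneg _))

/-- [folklore] **SUPPORT, instance**: a nonzero `ker₁ b c` is witnessed by a position `(x′, s)` with `c = n•y + x′ + s·e_μ` and a rule `σ` whose radial word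
contains `b`, or a straight position `j < s` with `b = strB (n•y + x′ + j·e_μ)`. -/
theorem blk_support {b : B} {c : Pt} (h : ker₁ (blkW n p) (blkFld n μ y) (blkBg n μ y rad strB) b c ≠ 0) :
    ∃ q ∈ idx n, ∃ s : σ, n • y + pt μ q = c ∧
      (b ∈ rad s y q.1 ∨ ∃ j < q.2, b = strB (n • y + pt μ (q.1, j))) := by
  obtain ⟨e, hc, hb⟩ := exists_of_ker₁_ne_zero h
  refine ⟨e.1.1, e.1.2, e.2, hc, ?_⟩
  unfold blkBg at hb
  rcases List.mem_append.mp hb with hb | hb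
  · exact Or.inl hb
  · right
    obtain ⟨j, hj, hjb⟩ := List.mem_map.mp hb
    exact ⟨j, List.mem_range.mp hj, hjb.symm⟩

omit [DecidableEq B] in
/-- [folklore] THE BLOCK FAMILY's COVARIANT AVERAGE (node 6 `avgPath` over the block events) has node 6's first-jet stencil as derivative at `0`. -/
theorem hasDerivAt_blkAvg_zero {𝔸 : Type*} [NormedRing 𝔸] [NormedAlgebra ℝ 𝔸] [CompleteSpace 𝔸] (n : ℕ) (μ : Fin 4) (y : Pt)
    (p : σ → ℝ) (rad : σ → Pt → Pt → List B) (strB : Pt → B) (β : B → 𝔸) (φ : Pt → 𝔸) :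
    HasDerivAt (avgPath ℝ (blkW n p) (fun e => (blkBg n μ y rad strB e).map β) (fun e => φ (blkFld n μ y e)))
      (avgJet₁ ℝ (blkW n p) (fun e => (blkBg n μ y rad strB e).map β) (fun e => φ (blkFld n μ y e))) 0 :=
  hasDerivAt_avgPath_zero ℝ _ _ _

/-- [folklore] THE KERNEL FORM for the block family, on any windows containing the letters and the field legs. -/
theorem blkJet₁_eq_sum_ker₁ {𝔸 : Type*} [NormedRing 𝔸] [NormedAlgebra ℝ 𝔸] (n : ℕ) (μ : Fin 4) (y : Pt) (p : σ → ℝ)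
    (rad : σ → Pt → Pt → List B) (strB : Pt → B) (S : Finset B) (T : Finset Pt) (hS : ∀ e, ∀ b ∈ blkBg n μ y rad strB e, b ∈ S)
    (hT : ∀ e : ↥(idx n) × σ, blkFld n μ y e ∈ T) (β : B → 𝔸) (φ : Pt → 𝔸) :
    avgJet₁ ℝ (blkW n p) (fun e => (blkBg n μ y rad strB e).map β) (fun e => φ (blkFld n μ y e))
      = ∑ b ∈ S, ∑ c ∈ T, ker₁ (blkW n p) (blkFld n μ y) (blkBg n μ y rad strB) b c • (β b * φ c - φ c * β b) :=
  avgJet₁_eq_sum_ker₁ _ _ _ S T hS hT β φ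

end Block

end Summit.QuantumFields.BalabanUV.Beta.FP.AveragingJetLettersRooted

end
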